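import Literature.MathematicalPhysics.QuantumFieldTheory.BalabanImbrieJaffe1984to88.BIJ88SlotFieldGaussBounds
import Literature.MathematicalPhysics.QuantumFieldTheory.BalabanImbrieJaffe1984to88.BIJ88PolymerRep5134GaussWitness

/-!
# `BalabanImbrieJaffe1984to88.BIJ88PairActivity309` — T. Bałaban, J. Imbrie, A. Jaffe, *Effective action and cluster properties of the abelian
Higgs model*, Commun. Math. Phys. **114** (1988) 257–315 [BalabanImbrieJaffe1988], Sect. 5.13 p. 305–306 [PDF 49–50] and Sect. 5.14 (5.14.3) p. 309
[PDF 53]: **THE ACTIVITY OF A TWO-CUBE POLYMER OF THE §5.13 MODEL AS THE COUPLED MINUS THE DECOUPLED EXPECTATION OF ONE SLOT PRODUCT, AND THE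
GAUSSIAN TAIL OF THE SLOT FIELDS UNDER EVERY REGION LAW FROM STRUCTURAL DATA** — the plumbing of `BIJ88Ineq5144TwoCube` ((5.14.4) on `|X_β| = 2`
for any coupling, p36 gen 17), split off to respect the 400-line bound.

statement-level skeleton of published theorems with citation tags; proofs where landed; nothing here is a claim about the Yang–Mills mass gap

PDF held: `paper:balaban1988-cmp114-bij-abelian-higgs-effective-action` (journal page = PDF page + 256); pp. 305–307, 309 read this generation (p. 307,
309 as x2 renders).  p. 305, verbatim: *"□_iΔ_s□_{i′} = s_is_{i′}□_iΔ□_{i′}, i′ ≠ i, □_iΔ_s□_i = □_iΔ□_i"*; p. 306, verbatim: *"Given some region X,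
a union of □_i, we sum Γ over all subsets of {i ∈ I: □_i ⊂ X}, such that X is a single cluster. … ⟨·⟩_{s_Γ,X} is defined by integrating over the
fields in X only."*; p. 309, verbatim: *"The polymer activity g₃ is essentially the same as g₂, but with additional observables, namely the
(d/dt)_γ-factors determined by H_β."*; p. 307, verbatim: *"These derivatives are supported at |A^{(k)″}| ≧ cp(e_k) or |φ^{(k)″}| ≧ cp(e_k) (here we
use the fact that the translation vanishes)."*

WHAT IS PROVED (unit `lit-balaban-p36`, generation 17 of the Phase-2 proof seat p36; SKELETON rows **C2.Eq5.14.3-5.14.4** / **C2.Eq5.13.3-5.13.4**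
member cells of `HOME/lit-balaban-r16/ROWS-C2-part2.md`, owner r16).  Data: the §5.13 model of this lineage (`BIJ88W6PrimeVsupp.actIn`).
* §1 `cornerSum_pair` (`Σ_{Λ′⊆{i,j}}(−1)^{|{i,j}∖Λ′|}F(Λ′) = F{i,j} − F{i} − F{j} + F∅`); `prec_corner_singleton_eq` / `zG_corner_singleton_eq` — ONE
  active cube activates NO pair: the `Y`-marginal precision at the corner `1_{{k}}` is the one at `1_∅`; `obs_fD_eq_prod_filter` — the product of the
  p. 308 cube factors over the cubes of `Y` is ONE product over the slots located in `Y`, multiplicities from `H`; **`actIn_pair_eq`** — for `i ≠ j`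
  the prime-dropped located activity of `(H, {i,j})` for the data of `X` at `(Λ, t, γ)` is `[{i,j} connected]·(∫Π dlaw_{1_{{i,j}}} − ∫Π dlaw_{1_∅})`
  (p25's `g1_of_two_le`: for a two-cube region only `Γ = X` makes `X` a single cluster, and only if the cubes abut).
* §2 `quadForm_interp_corner_ge` (`Δ ≥ m·1 ⇒ Δ_{1_Λ} ≥ m·1`, p02's `quadForm_interpForm_ge` at p25's `corner_mem_cube`), `interp_corner_posDef`, `src_dotProduct_self_eq_sum`,
  `src_pair_le` (`‖ℱ|_□‖₂² ≤ F²` per cube ⇒ `‖ℱ|_{□_i∪□_j}‖₂² ≤ (√2 F)²`), **`tail_slotField_regionLaw_of_struct`** — for the law of the fields of a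
  region `Y` at the corner `1_{Λ′}` of the resummed form `Δ_{1_Λ}` (`BIJ88Eq5145CornerModel.regionLaw`), a slot field that is a linear functional or a
  modulus with `|ℓ_jφ| ≤ Λ‖φ‖₂`, `Δ ≥ m·1`, `‖ℱ|_Y‖₂ ≤ F_Y`: `law{a ≤ |Φ_b|} ≤ 4e^{F_Y²/(2m)}e^{−(m/(8Λ²))a²}` (gen 16's
  `tail_slotField_fieldLaw_of_struct` at the iterated corner form, which inherits `≻ 0` and `≥ m·1`).
HONEST SCOPE: identities and Gaussian bookkeeping only; no estimate of (5.14.4) is in this file.  0 `sorry`, 0 definitions, 0 `Prop` facts (D-0026);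
imports `BIJ88SlotFieldGaussBounds` (p36 g16) and `BIJ88PolymerRep5134GaussWitness` (p25; `corner_mem_cube`); modifies nothing.  NOT summit progress; NOT continuum; NOT Clay.  Cell `lit-balaban` Phase 2,
seat p36 gen 17 (owner r16, referee ref-5).
-/

noncomputable section

open Finset MeasureTheory ProbabilityTheory Matrix
open Literature.MathematicalPhysics.QuantumFieldTheory.BalabanImbrieJaffe1984to88
open BIJ88Sect2Statements (pLog)
open BIJ88Sect5Statements (CutoffProfile cutoff)
open BIJ88SlotMoments308 (slotFactor)
open BIJ88DirichletForms305 (interpForm interpForm_apply quadForm_interpForm_ge interpForm_posDef)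
open BIJ88Clusters5134 (cornerSum act)
open BIJ88PolymerRep5134 (g1 g1_of_two_le IsConn corner corner_apply)
open BIJ88PolymerRep5134Gauss (ext obs prec src zG)
open BIJ88Expansion5143 (g3 prime prime_of_not)
open BIJ88Expansion5143Gauss (fD)
open BIJ88SlotMomentsGauss308 (uD fieldLaw measurable_ext)
open BIJ88Eq5145CornerModel (slotB slotY mem_slotB mem_slotY regionLaw zG_eq_integral_regionLaw isProbabilityMeasure_regionLaw)
open BIJ88Eq5145CornerUrsell (cubeIn cubeIn_mem)
open BIJ88W6PrimeVsupp (actIn)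
open BIJ88W6PrimeVsuppBound (card_filter_cubeIn_le)
open BIJ88Ineq5144Located (locAct locAct_of_loc locAct_of_not_loc)
open BIJ88OneCubeVertexFactors309 (abs_integral_prod_iteratedDeriv_slotFactor_le_pow abs_integral_prod_slotFactor_sub_one_le_rpow)
open BIJ88SlotFieldGaussBounds (tail_slotField_fieldLaw_of_struct tail_constants_eq sum_eq_sum_site)
open BIJ88PolymerRep5134GaussWitness (corner_mem_cube)

namespace Literature.MathematicalPhysics.QuantumFieldTheory.BalabanImbrieJaffe1984to88.BIJ88PairActivity309

/-! ## §1 The activity of a two-cube polymer: one slot product under two laws -/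

section CornerSum

variable {I : Type*} [DecidableEq I] {R : Type*} [CommRing R]

/-- **the corner sum over a pair**: `Σ_{Λ′⊆{i,j}} (−1)^{|{i,j}∖Λ′|} F(Λ′) = F{i,j} − F{i} − F{j} + F∅` (`i ≠ j`) — the `Γ = X` term of p. 306's
`g₁(X)` for a two-cube `X` (`∫∫ds_ids_j ∂²/∂s_i∂s_j` in corner form). [cite: BalabanImbrieJaffe1988, p.306 (Sect. 5.13); (5.13.3) p.305] -/
theorem cornerSum_pair (F : Finset I → R) {i j : I} (hij : i ≠ j) :
    cornerSum F {i, j} = F {i, j} - F {i} - F {j} + F ∅ := by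
  have hi : i ∉ ({j} : Finset I) := by rwa [mem_singleton]
  have hpj : ({j} : Finset I).powerset = {∅, {j}} := by
    ext s
    simp only [mem_powerset, Finset.subset_singleton_iff, mem_insert, mem_singleton]
  have hne : (∅ : Finset I) ≠ {j} := (singleton_ne_empty j).symm
  have h1 : (({i, j} : Finset I) \ ∅).card = 2 := by rw [sdiff_empty, card_pair hij]
  have h2 : (({i, j} : Finset I) \ {j}).card = 1 := by
    have : ({i, j} : Finset I) \ {j} = {i} := by
      ext x
      simp only [mem_sdiff, mem_insert, mem_singleton]
      constructor
      · rintro ⟨h | h, h'⟩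
        · exact h
        · exact absurd h h'
      · rintro rfl
        exact ⟨Or.inl rfl, hij⟩
    rw [this, card_singleton]
  have h3 : (({i, j} : Finset I) \ {i}).card = 1 := by
    have : ({i, j} : Finset I) \ {i} = {j} := by
      ext x
      simp only [mem_sdiff, mem_insert, mem_singleton]
      constructor
      · rintro ⟨h | h, h'⟩
        · exact absurd h h'
        · exact h
      · rintro rfl
        exact ⟨Or.inr rfl, hij.symm⟩
    rw [this, card_singleton]
  have h4 : (({i, j} : Finset I) \ {i, j}).card = 0 := by rw [sdiff_self, bot_eq_empty, card_empty]
  unfold cornerSum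
  rw [sum_powerset_insert hi, hpj, sum_pair hne, sum_pair hne, Finset.insert_empty, h1, h2, h3, h4]
  ring

end CornerSum

section Gauss

variable {α I : Type} [Fintype α] [DecidableEq α] [Fintype I] [DecidableEq I]
  (blk : α → I) (ℱ : α → ℝ)

/-- **ONE active cube activates NO pair** (p. 305: *"□_iΔ_s□_{i′} = s_is_{i′}□_iΔ□_{i′}, i′ ≠ i, □_iΔ_s□_i = □_iΔ□_i"*): the precision of the
`Y`-marginal at the corner `1_{{k}}` is the one at the corner `1_∅` (two different cubes are never both equal to `k`).
[cite: BalabanImbrieJaffe1988, p.305 (Sect. 5.13)] -/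
theorem prec_corner_singleton_eq (N : Matrix α α ℝ) (Y : Finset I) (k : I) :
    prec blk N Y (corner ℝ {k}) = prec blk N Y (corner ℝ ∅) := by
  ext x y
  simp only [prec, Matrix.submatrix_apply, interpForm_apply, corner_apply, mem_singleton, notMem_empty, if_false, zero_mul]
  by_cases hxy : blk x.1 = blk y.1
  · rw [if_pos hxy, if_pos hxy]
  · rw [if_neg hxy, if_neg hxy]
    by_cases hx : blk x.1 = k
    · have hy : ¬ blk y.1 = k := fun h => hxy (hx.trans h.symm)
      rw [if_neg hy, mul_zero, zero_mul]
    · rw [if_neg hx, zero_mul, zero_mul]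

/-- hence the corner expectation of a region with ONE active cube is the fully decoupled one: `z(Y)(1_{{k}}) = z(Y)(1_∅)`.
[cite: BalabanImbrieJaffe1988, p.305–306 (Sect. 5.13)] -/
theorem zG_corner_singleton_eq (N : Matrix α α ℝ) (f : I → (α → ℝ) → ℝ) (Y : Finset I) (k : I) :
    zG blk N ℱ f Y {k} = zG blk N ℱ f Y ∅ := by
  simp only [zG, BIJ88PolymerRep5134Gauss.expect, prec_corner_singleton_eq]

end Gauss

section Model

variable {α I : Type} [Fintype α] [DecidableEq α] [Fintype I] [DecidableEq I]
  (blk : α → I) (Δ : Matrix α α ℝ) (ℱ : α → ℝ)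
variable (adj : I → I → Prop) [DecidableRel adj]
variable (χ : CutoffProfile) {ι υ : Type*} [DecidableEq ι] [DecidableEq υ]
variable (p ek : ℝ) (B : Finset ι) (Φ : ι → (α → ℝ) → ℝ) (c : ι → ℝ) (Ys : Finset υ) (V : υ → (α → ℝ) → ℝ)
variable (cube : ↥B ⊕ ↥Ys → I)

omit [Fintype α] [DecidableEq α] [Fintype I] in
/-- **the product of the p. 308 cube factors over the cubes of `Y` is ONE product over the slots located in `Y`**, each slot factor
differentiated as many times as `H` assigns labels to it (p. 309: *"the (d/dt)_γ-factors determined by H_β"*).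
[cite: BalabanImbrieJaffe1988, (5.14.3) p.309; (5.14.2) p.308] -/
theorem obs_fD_eq_prod_filter (X Y : Finset I) (t : ℝ) {L : Type*} [DecidableEq L]
    (γ : L → ↥(slotB B Ys cube X) ⊕ ↥(slotY B Ys cube X)) (H : Finset L) (ω : {x : α // blk x ∈ Y} → ℝ) :
    obs blk (fD (uD χ p ek (slotB B Ys cube X) (fun b : ↥B => Φ b) (fun b : ↥B => c b) (slotY B Ys cube X) (fun Y' : ↥Ys => V Y') t)
        (cubeIn cube X) γ H) Y ω =
      ∏ τ ∈ univ.filter (fun τ => cubeIn cube X τ ∈ Y),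
        iteratedDeriv ((H.filter fun l => γ l = τ).card)
          (slotFactor χ p ek (slotB B Ys cube X) (fun b ω => Φ b (ext blk Y ω)) (fun b => c b) (slotY B Ys cube X)
            (fun Y' ω => V Y' (ext blk Y ω)) ω τ) t := by
  simp only [obs, fD, uD]
  rw [prod_fiberwise_eq_prod_filter]
  refine prod_congr rfl fun τ _ => ?_
  rcases τ with b | Y' <;> rfl

/-- **THE ACTIVITY OF A TWO-CUBE POLYMER** (p. 306: `g₁(X) = Σ_Γ ∫ds_Γ ∂_Γ⟨Π f(□_i)⟩_{s_Γ,X}` with `X` a single cluster — for `X = {i,j}` only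
`Γ = X` qualifies, and only if `□_i`, `□_j` abut; p. 309: `g₃` = `g₁` with the derivative observables of `H`): for `i ≠ j` the prime-dropped
located activity of `(H, {i,j})` for the data of the region `X` at `(Λ, t, γ)` is `[{i,j} connected]·(∫ Π dlaw_{1_{{i,j}}} − ∫ Π dlaw_{1_∅})`, the
integrand both times being the product over the slots located in `□_i ∪ □_j` of their slot factors differentiated as `H` prescribes — the corners
`1_{{i}}`, `1_{{j}}` of the corner sum contribute the decoupled expectation (`zG_corner_singleton_eq`).
[cite: BalabanImbrieJaffe1988, (5.14.3)–(5.14.4) p.309; p.306 (Sect. 5.13)] -/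
theorem actIn_pair_eq (Λ X : Finset I) (t : ℝ) {L : Type*} [DecidableEq L]
    (γ : L → ↥(slotB B Ys cube X) ⊕ ↥(slotY B Ys cube X)) (H : Finset L) {i j : I} (hij : i ≠ j) :
    actIn blk Δ ℱ adj χ p ek B Φ c Ys V cube Λ X t γ H {i, j} =
      if IsConn adj ({i, j} : Finset I) then
        (∫ ω, ∏ τ ∈ univ.filter (fun τ => cubeIn cube X τ ∈ ({i, j} : Finset I)),
            iteratedDeriv ((H.filter fun l => γ l = τ).card)
              (slotFactor χ p ek (slotB B Ys cube X) (fun b ω => Φ b (ext blk {i, j} ω)) (fun b => c b) (slotY B Ys cube X)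
                (fun Y' ω => V Y' (ext blk {i, j} ω)) ω τ) t
            ∂(regionLaw blk (interpForm blk Δ (corner ℝ Λ)) ℱ {i, j} {i, j})) -
        (∫ ω, ∏ τ ∈ univ.filter (fun τ => cubeIn cube X τ ∈ ({i, j} : Finset I)),
            iteratedDeriv ((H.filter fun l => γ l = τ).card)
              (slotFactor χ p ek (slotB B Ys cube X) (fun b ω => Φ b (ext blk {i, j} ω)) (fun b => c b) (slotY B Ys cube X)
                (fun Y' ω => V Y' (ext blk {i, j} ω)) ω τ) t
            ∂(regionLaw blk (interpForm blk Δ (corner ℝ Λ)) ℱ {i, j} ∅))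
      else 0 := by
  have h2 : 2 ≤ ({i, j} : Finset I).card := by rw [card_pair hij]
  simp only [actIn]
  rw [prime_of_not _ (fun h => by rw [card_pair hij] at h; exact absurd h.2 (by norm_num)), g3, g1_of_two_le adj _ h2]
  split_ifs with hc
  · rw [act, cornerSum_pair _ hij, zG_corner_singleton_eq, zG_corner_singleton_eq, zG_eq_integral_regionLaw, zG_eq_integral_regionLaw]
    simp_rw [obs_fD_eq_prod_filter]
    ring
  · rfl

end Model

/-! ## §2 Structural data pass to the corner forms; the Gaussian tail under every region law -/

section Struct

variable {α I : Type} [Fintype α] [DecidableEq α] [Fintype I] [DecidableEq I]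
  (blk : α → I) (Δ : Matrix α α ℝ) (ℱ : α → ℝ)

/-- **`Δ ≥ m·1 ⇒ Δ_{1_Λ} ≥ m·1`** (p. 305: Δ_s is a convex combination of the Dirichlet forms Δ_Γ — p02's `quadForm_interpForm_ge`).
[cite: BalabanImbrieJaffe1988, p.305 (Sect. 5.13)] -/
theorem quadForm_interp_corner_ge {m : ℝ} (hΔm : ∀ φ : α → ℝ, m * (φ ⬝ᵥ φ) ≤ φ ⬝ᵥ (Δ *ᵥ φ)) (Λ : Finset I) (φ : α → ℝ) :
    m * (φ ⬝ᵥ φ) ≤ φ ⬝ᵥ (interpForm blk Δ (corner ℝ Λ) *ᵥ φ) :=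
  quadForm_interpForm_ge blk hΔm (corner_mem_cube Λ) φ

/-- **`Δ ≻ 0 ⇒ Δ_{1_Λ} ≻ 0`** (p. 305 *"To preserve positivity"* — p02's `interpForm_posDef`). [cite: BalabanImbrieJaffe1988, p.305 (Sect. 5.13)] -/
theorem interp_corner_posDef (hΔ : Δ.PosDef) (Λ : Finset I) : (interpForm blk Δ (corner ℝ Λ)).PosDef :=
  interpForm_posDef blk hΔ (corner_mem_cube Λ)

omit [DecidableEq α] [Fintype I] in
/-- `‖ℱ|_W‖₂²` as a sum over all sites with the indicator of `W`. [cite: BalabanImbrieJaffe1988, p.305 (Sect. 5.13)] -/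
theorem src_dotProduct_self_eq_sum (W : Finset I) :
    src blk ℱ W ⬝ᵥ src blk ℱ W = ∑ x, if blk x ∈ W then ℱ x ^ 2 else 0 := by
  rw [sum_eq_sum_site blk W (g := fun x => if blk x ∈ W then ℱ x ^ 2 else 0) (fun x hx => if_neg hx)]
  simp only [dotProduct, BIJ88PolymerRep5134Gauss.src, pow_two]
  exact sum_congr rfl fun x _ => by rw [if_pos x.2]

omit [DecidableEq α] [Fintype I] in
/-- **the source on a pair of cubes from the source per cube**: `‖ℱ|_□‖₂² ≤ F²` for every cube gives `‖ℱ|_{□_i∪□_j}‖₂² ≤ (√2·F)²`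
(p. 307: where *"the translation vanishes"*, `F = 0`). [cite: BalabanImbrieJaffe1988, p.307 (Sect. 5.13); p.305] -/
theorem src_pair_le {F : ℝ} (hF : ∀ i : I, src blk ℱ {i} ⬝ᵥ src blk ℱ {i} ≤ F ^ 2) {i j : I} (hij : i ≠ j) :
    src blk ℱ {i, j} ⬝ᵥ src blk ℱ {i, j} ≤ (Real.sqrt 2 * F) ^ 2 := by
  have hi := hF i
  have hj := hF j
  rw [src_dotProduct_self_eq_sum] at hi hj ⊢
  have hsplit : ∑ x, (if blk x ∈ ({i, j} : Finset I) then ℱ x ^ 2 else 0) =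
      ∑ x, (if blk x ∈ ({i} : Finset I) then ℱ x ^ 2 else 0) + ∑ x, (if blk x ∈ ({j} : Finset I) then ℱ x ^ 2 else 0) := by
    rw [← sum_add_distrib]
    refine sum_congr rfl fun x _ => ?_
    simp only [mem_insert, mem_singleton]
    by_cases h1 : blk x = i
    · simp [h1, hij]
    · by_cases h2 : blk x = j
      · simp [h2, hij.symm]
      · simp [h1, h2]
  rw [hsplit, mul_pow, Real.sq_sqrt (by norm_num : (0 : ℝ) ≤ 2)]
  linarith

/-- **THE GAUSSIAN TAIL OF A SLOT FIELD UNDER EVERY REGION LAW, FROM STRUCTURAL DATA**: for the law of the fields of a region `Y` at the corner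
`1_{Λ′}` of the resummed form `Δ_{1_Λ}` (`BIJ88Eq5145CornerModel.regionLaw`), a slot field that is a linear functional `ℓ₁` or a modulus
`√(ℓ₁² + ℓ₂²)` with `|ℓ_j φ| ≤ Λ‖φ‖₂`, `Δ ≥ m·1`, `‖ℱ|_Y‖₂ ≤ F_Y`: `law{a ≤ |Φ_b(ext ω)|} ≤ 4e^{F_Y²/(2m)}e^{−(m/(8Λ²))a²}` — gen 16's
`tail_slotField_fieldLaw_of_struct` at the iterated corner form (which inherits `≻ 0` and `≥ m·1`).
[cite: BalabanImbrieJaffe1988, p.307 (Sect. 5.13); p.309 (Sect. 5.14); p.305] -/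
theorem tail_slotField_regionLaw_of_struct (hΔ : Δ.PosDef) {m : ℝ} (hm : 0 < m) (hΔm : ∀ φ : α → ℝ, m * (φ ⬝ᵥ φ) ≤ φ ⬝ᵥ (Δ *ᵥ φ))
    {Φb ℓ₁ ℓ₂ : (α → ℝ) → ℝ} (h₁ : IsLinearMap ℝ ℓ₁) (h₂ : IsLinearMap ℝ ℓ₂)
    (h : (∀ φ, Φb φ = ℓ₁ φ) ∨ (∀ φ, Φb φ = Real.sqrt (ℓ₁ φ ^ 2 + ℓ₂ φ ^ 2)))
    {Λ : ℝ} (hΛ : 0 < Λ) (hΛ₁ : ∀ φ : α → ℝ, |ℓ₁ φ| ≤ Λ * Real.sqrt (φ ⬝ᵥ φ)) (hΛ₂ : ∀ φ : α → ℝ, |ℓ₂ φ| ≤ Λ * Real.sqrt (φ ⬝ᵥ φ))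
    {FY : ℝ} (hF0 : 0 ≤ FY) (Y : Finset I) (hF : src blk ℱ Y ⬝ᵥ src blk ℱ Y ≤ FY ^ 2) (Λ₀ Λ' : Finset I) {a : ℝ} (ha : 0 ≤ a) :
    (regionLaw blk (interpForm blk Δ (corner ℝ Λ₀)) ℱ Y Λ').real {ω | a ≤ |Φb (ext blk Y ω)|} ≤
      4 * Real.exp (FY ^ 2 / (2 * m)) * Real.exp (-(m / (8 * Λ ^ 2) * a ^ 2)) := by
  obtain ⟨hc1, hc2⟩ := tail_constants_eq hm hΛ FY
  rw [← hc1, ← hc2]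
  exact tail_slotField_fieldLaw_of_struct blk (interpForm blk (interpForm blk Δ (corner ℝ Λ₀)) (corner ℝ Λ')) ℱ Y
    (interp_corner_posDef blk _ (interp_corner_posDef blk Δ hΔ Λ₀) Λ') hm
    (fun φ => quadForm_interp_corner_ge blk _ (quadForm_interp_corner_ge blk Δ hΔm Λ₀) Λ' φ) h₁ h₂ h hΛ hΛ₁ hΛ₂ hF0 hF ha

end Struct

end Literature.MathematicalPhysics.QuantumFieldTheory.BalabanImbrieJaffe1984to88.BIJ88PairActivity309

end
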